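import Summits.BirchSwinnertonDyer.BirchSwinnertonDyer.Theorems.ManinLocalTwoThreeKummerSquareCharacterEndgame
import HarnessLib

/-!
# KUMMER–SHIMURA AT ℓ = 2: the multipliers of the `σ`-square root are the WEIL SIGNS `(−1)^{k₂m₁ − k₁m₂}`, and Γ₁(N)-periodicity puts `Λ₁(f)` inside
# the index-`2` line `ℤ·(2a/c) + 2Λ₀(f)` — «`2 ∣ c` puts `T` in the Shimura kernel» made exact (unconditional lattice/σ algebra)
(route `ManinLocalTwoThree`, deciding crux C2 `ManinOddAtFour` stmt-BirchSwinnertonDyer-22967; cell bsd-f2-manin, C2/C3 LEAD p1 gen 18;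
`--supports stmt-BirchSwinnertonDyer-22967`; sequel to `…KummerSquareCharacterEndgame` (p746256); the ℓ = 2 twin of the tree's DICTΣ
`UDCKummerLineK.KummerShimuraLattice` / `kummerShimuraLattice_holds` («a Kummer–Shimura third-period puts `Λ₁(f)` inside `ℤ·(3u/c) + 3Λ₀(f)`»))

SETTING.  `L` a period pair (lattice `Λ`), `a ∉ Λ` with `2a = m₁ω₁ + m₂ω₂`, `e = m₁η₁ + m₂η₂`, `V = sigmaSqRoot L a e` (p2 g16).  §1 computes the
multiplier of `V` under ANY `μ = k₁ω₁ + k₂ω₂ ∈ Λ`: **`V(w + μ) = exp((k₂m₁ − k₁m₂)·s·πi)·V(w) = (−1)^{k₂m₁ − k₁m₂}·V(w)`** (`s = ±1` the orientation sign of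
Legendre's relation) — the Weil pairing `e₂(T, μ/2)`; hence (§2) **`V` is `μ`-periodic ⟺ `2 ∣ k₂m₁ − k₁m₂`**, i.e. the periods of `V` inside `Λ` form the
index-`2` sublattice `2Λ + ℤ·2a`.  §3, for a lattice-optimal `X₀(N)`-datum `D` (`Λ = Λ_W = c·Λ₀(f)`): if `V` is periodic under `c·{∞,γ∞}_f` for every
`γ ∈ Γ₁(N)` (the conclusion a UDC line at ℓ = 2 would reach from `2 ∣ c`), then
* **`periodLatticeGamma1_le_kummerLineTwo`**: every `z ∈ Λ₁(f)` is `k·(2a/c) + 2v` with `v ∈ Λ₀(f)` — `Λ₁(f) ⊆ ℤ·(2a/c) + 2Λ₀(f)`, the index-`2` line of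
  the `2`-torsion point `T ↔ a`;
* **`periodLatticeGamma1_eq_kummerLineTwo_or_eq_two_mul`** (`4 ∣ N`, so `2Λ₀ ⊆ Λ₁`): EITHER `Λ₁(f) = ℤ·(2a/c) + 2Λ₀(f)` (index `2`, the Shimura-kernel point
  of `E₀ → E₁` IS `T`) OR `Λ₁(f) = 2Λ₀(f)` (index `4`);
* **`periodLatticeGamma1_eq_two_mul_of_two_halfPeriods`**: periodicity for TWO `2`-torsion points `T ≠ T′` (`a − a′ ∉ Λ`) forces index `4` — excluded
  wherever E-an-152b is a theorem (`…ShimuraQuotientLevelInstances`, `…QuarterShiftGamma1Orbit`), and (p745958) forcing analytic rank `0`.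
HONEST FRAMING: unconditional σ-function/lattice algebra; NO step of an ℓ = 2 UDC chain upstream of the periodicity hypothesis is proved here; C2, Manin's
conjecture and BSD are NOT proved.  No definitions, no sorry.
[cite: WhittakerWatson1927, §20.421 (quasi-periodicity of σ), §20.411 (Legendre's relation)] [cite: SilvermanAEC2009, III.8 (Weil pairing; shape)]
[cite: Stevens1989, §2 (the Shimura covering E₁ → E₀)]
-/

set_option autoImplicit false
-- lint-debt: the directory name repeats the summit name (sibling precedent `ManinLocalTwoThreeKummerSquareCharacterEndgame.lean`)
set_option linter.dupNamespace false

noncomputable section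

open scoped MatrixGroups ModularForm PeriodPair
open CongruenceSubgroup Complex
open WeierstrassCurve Literature.NumberTheory.EllipticCurves Literature.NumberTheory.EllipticCurves.ModularForms
open Summit.BirchSwinnertonDyer.BirchSwinnertonDyer.Theorems.ManinLocalTwoThree.SigmaSquareRoot

namespace Summit.BirchSwinnertonDyer.BirchSwinnertonDyer.Theorems.ManinLocalTwoThree.SigmaHabitat

/-! ## §1 The multiplier of `V` under an arbitrary lattice vector -/

section Multiplier

variable (L : PeriodPair) (a e : ℂ)

/-- `V(w + k·ω₁) = exp(k·A₁)·V(w)`, `A₁ = (eω₁ − 2aη₁)/2`, for every `k ∈ ℤ`. [cite: WhittakerWatson1927, §20.421] -/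
theorem sigmaSqRoot_add_intMul_ω₁ (k : ℤ) (w : ℂ) :
    sigmaSqRoot L a e (w + k * L.ω₁) = cexp (k * ((e * L.ω₁ - 2 * a * L.η₁) / 2)) * sigmaSqRoot L a e w := by
  induction k using Int.induction_on generalizing w with
  | zero => simp
  | succ k ih =>
    push_cast at ih ⊢
    rw [show w + ((k : ℂ) + 1) * L.ω₁ = (w + (k : ℂ) * L.ω₁) + L.ω₁ by ring, sigmaSqRoot_add_ω₁, ih, ← mul_assoc,
      ← Complex.exp_add]
    congr 1; ring
  | pred k ih =>
    push_cast at ih ⊢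
    have hE : cexp ((e * L.ω₁ - 2 * a * L.η₁) / 2) ≠ 0 := Complex.exp_ne_zero _
    have h := sigmaSqRoot_add_ω₁ L a e (w + (-(k : ℂ) - 1) * L.ω₁)
    rw [show w + (-(k : ℂ) - 1) * L.ω₁ + L.ω₁ = w + (-(k : ℂ)) * L.ω₁ by ring, ih] at h
    calc sigmaSqRoot L a e (w + (-(k : ℂ) - 1) * L.ω₁)
        = (cexp ((e * L.ω₁ - 2 * a * L.η₁) / 2))⁻¹ *
            (cexp (-(k : ℂ) * ((e * L.ω₁ - 2 * a * L.η₁) / 2)) * sigmaSqRoot L a e w) := by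
          rw [h, inv_mul_cancel_left₀ hE]
      _ = cexp ((-(k : ℂ) - 1) * ((e * L.ω₁ - 2 * a * L.η₁) / 2)) * sigmaSqRoot L a e w := by
          rw [← Complex.exp_neg, ← mul_assoc, ← Complex.exp_add]
          congr 1; ring

/-- `V(w + k·ω₂) = exp(k·A₂)·V(w)`, `A₂ = (eω₂ − 2aη₂)/2`, for every `k ∈ ℤ`. [cite: WhittakerWatson1927, §20.421] -/
theorem sigmaSqRoot_add_intMul_ω₂ (k : ℤ) (w : ℂ) :
    sigmaSqRoot L a e (w + k * L.ω₂) = cexp (k * ((e * L.ω₂ - 2 * a * L.η₂) / 2)) * sigmaSqRoot L a e w := by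
  induction k using Int.induction_on generalizing w with
  | zero => simp
  | succ k ih =>
    push_cast at ih ⊢
    rw [show w + ((k : ℂ) + 1) * L.ω₂ = (w + (k : ℂ) * L.ω₂) + L.ω₂ by ring, sigmaSqRoot_add_ω₂, ih, ← mul_assoc,
      ← Complex.exp_add]
    congr 1; ring
  | pred k ih =>
    push_cast at ih ⊢
    have hE : cexp ((e * L.ω₂ - 2 * a * L.η₂) / 2) ≠ 0 := Complex.exp_ne_zero _
    have h := sigmaSqRoot_add_ω₂ L a e (w + (-(k : ℂ) - 1) * L.ω₂)
    rw [show w + (-(k : ℂ) - 1) * L.ω₂ + L.ω₂ = w + (-(k : ℂ)) * L.ω₂ by ring, ih] at h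
    calc sigmaSqRoot L a e (w + (-(k : ℂ) - 1) * L.ω₂)
        = (cexp ((e * L.ω₂ - 2 * a * L.η₂) / 2))⁻¹ *
            (cexp (-(k : ℂ) * ((e * L.ω₂ - 2 * a * L.η₂) / 2)) * sigmaSqRoot L a e w) := by
          rw [h, inv_mul_cancel_left₀ hE]
      _ = cexp ((-(k : ℂ) - 1) * ((e * L.ω₂ - 2 * a * L.η₂) / 2)) * sigmaSqRoot L a e w := by
          rw [← Complex.exp_neg, ← mul_assoc, ← Complex.exp_add]
          congr 1; ring

/-- `V(w + (k₁ω₁ + k₂ω₂)) = exp(k₁A₁ + k₂A₂)·V(w)`. [cite: WhittakerWatson1927, §20.421] -/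
theorem sigmaSqRoot_add_pair (k₁ k₂ : ℤ) (w : ℂ) :
    sigmaSqRoot L a e (w + ((k₁ : ℂ) * L.ω₁ + (k₂ : ℂ) * L.ω₂)) =
      cexp (k₁ * ((e * L.ω₁ - 2 * a * L.η₁) / 2) + k₂ * ((e * L.ω₂ - 2 * a * L.η₂) / 2)) * sigmaSqRoot L a e w := by
  rw [show w + ((k₁ : ℂ) * L.ω₁ + (k₂ : ℂ) * L.ω₂) = (w + (k₁ : ℂ) * L.ω₁) + (k₂ : ℂ) * L.ω₂ by ring,
    sigmaSqRoot_add_intMul_ω₂, sigmaSqRoot_add_intMul_ω₁, ← mul_assoc, ← Complex.exp_add]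
  congr 1; ring

end Multiplier

/-! ## §2 For a half-period the multipliers are the Weil signs -/

/-- **The Weil sign.**  For `a ∉ Λ`, `2a = m₁ω₁ + m₂ω₂`, `e = m₁η₁ + m₂η₂`: there is an orientation sign `s = ±1` (Legendre: `η₁ω₂ − η₂ω₁ = s·2πi`) with
`V(w + (k₁ω₁ + k₂ω₂)) = exp((k₂m₁ − k₁m₂)·s·2πi/2)·V(w)` for all `k₁, k₂, w` — the multiplier is `(−1)^{k₂m₁ − k₁m₂} = e₂(T, ·)`.
[cite: WhittakerWatson1927, §20.421, §20.411] [cite: SilvermanAEC2009, III.8] -/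
theorem exists_sign_sigmaSqRoot_add_pair (L : PeriodPair) (a : ℂ) (m₁ m₂ : ℤ) (h2a : 2 * a = m₁ * L.ω₁ + m₂ * L.ω₂) :
    ∃ s : ℤ, (s = 1 ∨ s = -1) ∧ ∀ (k₁ k₂ : ℤ) (w : ℂ),
      sigmaSqRoot L a (m₁ * L.η₁ + m₂ * L.η₂) (w + ((k₁ : ℂ) * L.ω₁ + (k₂ : ℂ) * L.ω₂)) =
        cexp (((k₂ * m₁ - k₁ * m₂ : ℤ) : ℂ) * ((s : ℂ) * (2 * Real.pi * I)) / 2) *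
          sigmaSqRoot L a (m₁ * L.η₁ + m₂ * L.η₂) w := by
  obtain ⟨s, hs, hδ⟩ : ∃ s : ℤ, (s = 1 ∨ s = -1) ∧ L.η₁ * L.ω₂ - L.η₂ * L.ω₁ = (s : ℂ) * (2 * Real.pi * I) := by
    rcases L.im_ω₂_div_ω₁_pos_or with h | h
    · exact ⟨1, Or.inl rfl, by rw [L.legendre_relation_holds h]; simp⟩
    · refine ⟨-1, Or.inr rfl, ?_⟩
      have h' := L.legendre_relation_of_neg h
      linear_combination -h'
  refine ⟨s, hs, fun k₁ k₂ w ↦ ?_⟩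
  rw [sigmaSqRoot_add_pair]
  congr 2
  have e2a : (2 : ℂ) * a = m₁ * L.ω₁ + m₂ * L.ω₂ := h2a
  push_cast
  linear_combination ((k₂ : ℂ) * m₁ / 2 - (k₁ : ℂ) * m₂ / 2) * hδ - ((k₁ : ℂ) * L.η₁ / 2 + (k₂ : ℂ) * L.η₂ / 2) * e2a

/-- `exp(n·s·2πi/2) = 1` for even `n` (`s ∈ ℤ`). [folklore] -/
theorem cexp_eq_one_of_two_dvd {s n : ℤ} (hn : (2 : ℤ) ∣ n) :
    cexp ((n : ℂ) * ((s : ℂ) * (2 * Real.pi * I)) / 2) = 1 := by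
  obtain ⟨n', rfl⟩ := hn
  rw [show (((2 * n' : ℤ)) : ℂ) * ((s : ℂ) * (2 * Real.pi * I)) / 2 = ((n' * s : ℤ) : ℂ) * (2 * Real.pi * I) by push_cast; ring]
  exact Complex.exp_int_mul_two_pi_mul_I _

/-- **`V` is `μ`-periodic ⟺ the Weil sign is `+1`**: for `a ∉ Λ` (`2a = m₁ω₁ + m₂ω₂`, `e = m₁η₁ + m₂η₂`) and `μ = k₁ω₁ + k₂ω₂`:
`(∀ w, V(w + μ) = V w) ⟺ 2 ∣ k₂m₁ − k₁m₂`. [cite: WhittakerWatson1927, §20.421, §20.411] [cite: SilvermanAEC2009, III.8] -/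
theorem sigmaSqRoot_pair_periodic_iff (L : PeriodPair) {a : ℂ} {m₁ m₂ : ℤ} (ha : a ∉ L.lattice)
    (h2a : 2 * a = m₁ * L.ω₁ + m₂ * L.ω₂) (k₁ k₂ : ℤ) :
    (∀ w : ℂ, sigmaSqRoot L a (m₁ * L.η₁ + m₂ * L.η₂) (w + ((k₁ : ℂ) * L.ω₁ + (k₂ : ℂ) * L.ω₂)) =
        sigmaSqRoot L a (m₁ * L.η₁ + m₂ * L.η₂) w) ↔ (2 : ℤ) ∣ k₂ * m₁ - k₁ * m₂ := by
  obtain ⟨s, hs, hmul⟩ := exists_sign_sigmaSqRoot_add_pair L a m₁ m₂ h2a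
  constructor
  · intro hper
    -- evaluate at `w = a/2`, where `V ≠ 0`
    have hh : a / 2 ∉ L.lattice := fun h ↦ ha (by
      have := L.lattice.add_mem h h
      rwa [add_halves] at this)
    have hha : a / 2 - a ∉ L.lattice := fun h ↦ hh (by
      have := L.lattice.neg_mem h
      rwa [show -(a / 2 - a) = a / 2 by ring] at this)
    have hV0 := sigmaSqRoot_ne_zero L a (m₁ * L.η₁ + m₂ * L.η₂) hh hha
    have h := hper (a / 2)
    rw [hmul] at h
    exact two_dvd_of_cexp_eq_one hs (mul_right_cancel₀ hV0 (h.trans (one_mul _).symm))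
  · intro hdvd w
    rw [hmul, cexp_eq_one_of_two_dvd hdvd, one_mul]

/-- `m₁, m₂` are not both even when `a ∉ Λ` and `2a = m₁ω₁ + m₂ω₂`. [folklore] -/
theorem not_two_dvd_and_of_halfPeriod (L : PeriodPair) {a : ℂ} {m₁ m₂ : ℤ} (ha : a ∉ L.lattice)
    (h2a : 2 * a = m₁ * L.ω₁ + m₂ * L.ω₂) : ¬ ((2 : ℤ) ∣ m₁ ∧ (2 : ℤ) ∣ m₂) := by
  rintro ⟨⟨n₁, hn₁⟩, ⟨n₂, hn₂⟩⟩
  apply ha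
  rw [PeriodPair.mem_lattice]
  refine ⟨n₁, n₂, ?_⟩
  have h2 : (2 : ℂ) * a = 2 * (n₁ * L.ω₁ + n₂ * L.ω₂) := by rw [h2a, hn₁, hn₂]; push_cast; ring
  exact (mul_left_cancel₀ (by norm_num : (2 : ℂ) ≠ 0) h2).symm

/-! ## §3 Γ₁(N)-periodicity puts `Λ₁(f)` inside the index-`2` line of `T` -/

section Shimura

variable {W : WeierstrassCurve ℚ} {N : ℕ} [NeZero N]

/-- **KUMMER–SHIMURA AT ℓ = 2 (lattice form).**  `D` lattice-optimal (`Λ_W = c·Λ₀(f)`), `a ∉ Λ_W` a half-period (`2a = m₁ω₁ + m₂ω₂`), `V = sigmaSqRoot Λ_W a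
(m₁η₁ + m₂η₂)`.  If `V` is periodic under `c·{∞,γ∞}_f` for every `γ ∈ Γ₁(N)`, then **every `z ∈ Λ₁(f)` is `k·(2a/c) + 2v` with `k ∈ ℤ`, `v ∈ Λ₀(f)`** —
`Λ₁(f) ⊆ ℤ·(2a/c) + 2Λ₀(f)`, the `2`-isogeny line of the torsion point `T ↔ a`. [cite: Stevens1989, §2] [cite: SilvermanAEC2009, III.8] -/
theorem periodLatticeGamma1_le_kummerLineTwo (D : ModularParametrizationData W N)
    (hopt : ∀ z ∈ D.L.lattice, ∃ w ∈ periodLattice D.f, z = D.c * w) {a : ℂ} {m₁ m₂ : ℤ} (ha : a ∉ D.L.lattice)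
    (h2a : 2 * a = m₁ * D.L.ω₁ + m₂ * D.L.ω₂)
    (hper : ∀ γ : Gamma1 N, ∀ w : ℂ,
      sigmaSqRoot D.L a (m₁ * D.L.η₁ + m₂ * D.L.η₂) (w + (D.c : ℂ) * cuspSymbol D.f ⟨(γ : SL(2, ℤ)), Gamma1_in_Gamma0 N γ.2⟩) =
        sigmaSqRoot D.L a (m₁ * D.L.η₁ + m₂ * D.L.η₂) w) :
    ∀ z ∈ periodLatticeGamma1 D.f, ∃ k : ℤ, ∃ v ∈ periodLattice D.f, z = k * (2 * a / D.c) + 2 * v := by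
  have hc : (D.c : ℂ) ≠ 0 := D.cast_c_ne_zero
  intro z hz
  -- `c z ∈ Λ`, write it on the basis; the periodicity gives the parity condition
  have hzΛ : (D.c : ℂ) * z ∈ D.L.lattice := D.smul_periodLattice_le z (periodLatticeGamma1_le_periodLattice D.f hz)
  obtain ⟨k₁, k₂, hk⟩ := PeriodPair.mem_lattice.mp hzΛ
  have hperz := sigmaSqRoot_periodic_of_mem_periodLatticeGamma1 D a _ hper z hz
  rw [← hk] at hperz
  have hpar : (2 : ℤ) ∣ k₂ * m₁ - k₁ * m₂ := (sigmaSqRoot_pair_periodic_iff D.L ha h2a k₁ k₂).mp hperz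
  have hnb := not_two_dvd_and_of_halfPeriod D.L ha h2a
  -- choose `k` with `(k₁, k₂) ≡ k·(m₁, m₂) (mod 2)`
  obtain ⟨k, j₁, j₂, hj₁, hj₂⟩ : ∃ k j₁ j₂ : ℤ, k₁ - k * m₁ = 2 * j₁ ∧ k₂ - k * m₂ = 2 * j₂ := by
    obtain ⟨q, hq⟩ := hpar
    rcases Int.even_or_odd m₁ with ⟨n₁, hn₁⟩ | ⟨n₁, hn₁⟩
    · -- `m₁` even ⟹ `m₂` odd; take `k = k₂`
      have hm₂ : Odd m₂ := Int.not_even_iff_odd.mp fun h ↦ hnb ⟨⟨n₁, by rw [hn₁]; ring⟩, even_iff_two_dvd.mp h⟩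
      obtain ⟨n₂, hn₂⟩ := hm₂
      exact ⟨k₂, -q - k₁ * n₂, -k₂ * n₂, by linear_combination -hq - k₁ * hn₂, by rw [hn₂]; ring⟩
    · -- `m₁` odd; take `k = k₁`
      exact ⟨k₁, -k₁ * n₁, q - k₂ * n₁, by rw [hn₁]; ring, by linear_combination hq - k₂ * hn₁⟩
  -- `v' = j₁ω₁ + j₂ω₂ ∈ Λ = c·Λ₀`
  have hv' : (j₁ : ℂ) * D.L.ω₁ + (j₂ : ℂ) * D.L.ω₂ ∈ D.L.lattice := PeriodPair.mem_lattice.mpr ⟨j₁, j₂, rfl⟩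
  obtain ⟨v, hv, hvEq⟩ := hopt _ hv'
  refine ⟨k, v, hv, ?_⟩
  apply mul_left_cancel₀ hc
  rw [hk.symm, mul_add, show (D.c : ℂ) * (k * (2 * a / D.c)) = k * (2 * a) by field_simp, h2a,
    show (D.c : ℂ) * (2 * v) = 2 * ((D.c : ℂ) * v) by ring, ← hvEq]
  have e1 : (k₁ : ℂ) = k * m₁ + 2 * j₁ := by exact_mod_cast (by linarith [hj₁] : k₁ = k * m₁ + 2 * j₁)
  have e2 : (k₂ : ℂ) = k * m₂ + 2 * j₂ := by exact_mod_cast (by linarith [hj₂] : k₂ = k * m₂ + 2 * j₂)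
  rw [e1, e2]; ring

/-- `2a/c ∈ Λ₀(f)` (since `2a ∈ Λ_W = c·Λ₀(f)`). -/
theorem two_mul_halfPeriod_div_mem_periodLattice (D : ModularParametrizationData W N)
    (hopt : ∀ z ∈ D.L.lattice, ∃ w ∈ periodLattice D.f, z = D.c * w) {a : ℂ} {m₁ m₂ : ℤ}
    (h2a : 2 * a = m₁ * D.L.ω₁ + m₂ * D.L.ω₂) : 2 * a / (D.c : ℂ) ∈ periodLattice D.f := by
  have hc : (D.c : ℂ) ≠ 0 := D.cast_c_ne_zero
  have h2aΛ : 2 * a ∈ D.L.lattice := PeriodPair.mem_lattice.mpr ⟨m₁, m₂, h2a.symm⟩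
  obtain ⟨w, hw, hEq⟩ := hopt _ h2aΛ
  rwa [hEq, mul_div_cancel_left₀ _ hc]

/-- **THE ℓ = 2 DICHOTOMY at `4 ∣ N`** (`2Λ₀ ⊆ Λ₁`): under the Γ₁(N)-periodicity of `V`, EITHER `Λ₁(f) = ℤ·(2a/c) + 2Λ₀(f)` (index `2`: the kernel of
`E₀ → E₁` is generated by `T`) OR `Λ₁(f) = 2Λ₀(f)` (index `4`). [cite: Stevens1989, §2] -/
theorem periodLatticeGamma1_eq_kummerLineTwo_or_eq_two_mul (D : ModularParametrizationData W N)
    (hopt : ∀ z ∈ D.L.lattice, ∃ w ∈ periodLattice D.f, z = D.c * w) (h4 : 2 ^ 2 ∣ N) {a : ℂ} {m₁ m₂ : ℤ}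
    (ha : a ∉ D.L.lattice) (h2a : 2 * a = m₁ * D.L.ω₁ + m₂ * D.L.ω₂)
    (hper : ∀ γ : Gamma1 N, ∀ w : ℂ,
      sigmaSqRoot D.L a (m₁ * D.L.η₁ + m₂ * D.L.η₂) (w + (D.c : ℂ) * cuspSymbol D.f ⟨(γ : SL(2, ℤ)), Gamma1_in_Gamma0 N γ.2⟩) =
        sigmaSqRoot D.L a (m₁ * D.L.η₁ + m₂ * D.L.η₂) w) :
    (∀ z : ℂ, z ∈ periodLatticeGamma1 D.f ↔ ∃ k : ℤ, ∃ v ∈ periodLattice D.f, z = k * (2 * a / D.c) + 2 * v) ∨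
      (∀ z : ℂ, z ∈ periodLatticeGamma1 D.f ↔ ∃ w ∈ periodLattice D.f, z = 2 * w) := by
  have hline := periodLatticeGamma1_le_kummerLineTwo D hopt ha h2a hper
  have h2a0 := two_mul_halfPeriod_div_mem_periodLattice D hopt h2a
  have htwo : ∀ w ∈ periodLattice D.f, 2 * w ∈ periodLatticeGamma1 D.f :=
    fun w hw ↦ by exact_mod_cast two_mul_mem_periodLatticeGamma1_of_four_dvd D h4 hw
  by_cases hT : 2 * a / (D.c : ℂ) ∈ periodLatticeGamma1 D.f
  · refine Or.inl fun z ↦ ⟨hline z, ?_⟩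
    rintro ⟨k, v, hv, rfl⟩
    have h1 := (periodLatticeGamma1 D.f).zsmul_mem hT k
    rw [zsmul_eq_mul] at h1
    exact add_mem h1 (htwo v hv)
  · refine Or.inr fun z ↦ ⟨fun hz ↦ ?_, ?_⟩
    · obtain ⟨k, v, hv, rfl⟩ := hline z hz
      rcases Int.even_or_odd k with ⟨j, hj⟩ | ⟨j, hj⟩
      · refine ⟨j * (2 * a / D.c) + v, add_mem ?_ hv, by rw [hj]; push_cast; ring⟩
        have := (periodLattice D.f).zsmul_mem h2a0 j
        rwa [zsmul_eq_mul] at this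
      · exfalso
        apply hT
        -- `2a/c = z − 2·(j·(2a/c) + v)` with `z ∈ Λ₁` and `2·(…) ∈ Λ₁`
        have hmem : 2 * ((j : ℂ) * (2 * a / D.c) + v) ∈ periodLatticeGamma1 D.f := by
          refine htwo _ (add_mem ?_ hv)
          have := (periodLattice D.f).zsmul_mem h2a0 j
          rwa [zsmul_eq_mul] at this
        have hsub := sub_mem hz hmem
        have e : (k : ℂ) * (2 * a / D.c) + 2 * v - 2 * ((j : ℂ) * (2 * a / D.c) + v) = 2 * a / D.c := by
          rw [hj]; push_cast; ring
        rwa [e] at hsub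
    · rintro ⟨w, hw, rfl⟩
      exact htwo w hw

/-- **TWO periodic half-periods force index `4`.**  If `V_a` AND `V_{a′}` are both Γ₁(N)-periodic for `2`-torsion points `T ≠ T′` (`a − a′ ∉ Λ`), then
`Λ₁(f) ⊆ 2Λ₀(f)`; at `4 ∣ N` hence `Λ₁(f) = 2Λ₀(f)` — index `4`, excluded at every level where E-an-152b is a theorem. [cite: Stevens1989, §2] -/
theorem periodLatticeGamma1_eq_two_mul_of_two_halfPeriods (D : ModularParametrizationData W N)
    (hopt : ∀ z ∈ D.L.lattice, ∃ w ∈ periodLattice D.f, z = D.c * w) (h4 : 2 ^ 2 ∣ N)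
    {a a' : ℂ} {m₁ m₂ m₁' m₂' : ℤ} (ha : a ∉ D.L.lattice) (h2a : 2 * a = m₁ * D.L.ω₁ + m₂ * D.L.ω₂)
    (ha' : a' ∉ D.L.lattice) (h2a' : 2 * a' = m₁' * D.L.ω₁ + m₂' * D.L.ω₂) (hne : a - a' ∉ D.L.lattice)
    (hper : ∀ γ : Gamma1 N, ∀ w : ℂ,
      sigmaSqRoot D.L a (m₁ * D.L.η₁ + m₂ * D.L.η₂) (w + (D.c : ℂ) * cuspSymbol D.f ⟨(γ : SL(2, ℤ)), Gamma1_in_Gamma0 N γ.2⟩) =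
        sigmaSqRoot D.L a (m₁ * D.L.η₁ + m₂ * D.L.η₂) w)
    (hper' : ∀ γ : Gamma1 N, ∀ w : ℂ,
      sigmaSqRoot D.L a' (m₁' * D.L.η₁ + m₂' * D.L.η₂) (w + (D.c : ℂ) * cuspSymbol D.f ⟨(γ : SL(2, ℤ)), Gamma1_in_Gamma0 N γ.2⟩) =
        sigmaSqRoot D.L a' (m₁' * D.L.η₁ + m₂' * D.L.η₂) w) :
    ∀ z : ℂ, z ∈ periodLatticeGamma1 D.f ↔ ∃ w ∈ periodLattice D.f, z = 2 * w := by
  have hc : (D.c : ℂ) ≠ 0 := D.cast_c_ne_zero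
  rcases periodLatticeGamma1_eq_kummerLineTwo_or_eq_two_mul D hopt h4 ha h2a hper with hA | hA
  · rcases periodLatticeGamma1_eq_kummerLineTwo_or_eq_two_mul D hopt h4 ha' h2a' hper' with hB | hB
    · -- both lines: then `2a/c ∈ Λ₁ = line(a′)`, so `2a/c = k·(2a′/c) + 2v`; parity of `k` gives `a ∈ Λ` or `a − a′ ∈ Λ`
      exfalso
      have hTa : 2 * a / (D.c : ℂ) ∈ periodLatticeGamma1 D.f :=
        (hA _).mpr ⟨1, 0, zero_mem _, by simp⟩
      obtain ⟨k, v, hv, hkv⟩ := (hB _).mp hTa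
      have hvΛ : (D.c : ℂ) * v ∈ D.L.lattice := D.smul_periodLattice_le v hv
      have h2a'Λ : 2 * a' ∈ D.L.lattice := PeriodPair.mem_lattice.mpr ⟨m₁', m₂', h2a'.symm⟩
      -- `2a = k·2a′ + 2·(c v)`
      have hrel : 2 * a = (k : ℂ) * (2 * a') + 2 * ((D.c : ℂ) * v) := by
        have := congrArg (fun x ↦ (D.c : ℂ) * x) hkv
        rw [mul_div_cancel₀ _ hc] at this
        rw [this]; field_simp
      rcases Int.even_or_odd k with ⟨j, hj⟩ | ⟨j, hj⟩
      · -- `k = 2j`: `a = j·2a′ + c v ∈ Λ`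
        apply ha
        have e : a = (j : ℂ) * (2 * a') + (D.c : ℂ) * v := by
          have h2 : (2 : ℂ) * a = 2 * ((j : ℂ) * (2 * a') + (D.c : ℂ) * v) := by rw [hrel, hj]; push_cast; ring
          exact mul_left_cancel₀ (by norm_num : (2 : ℂ) ≠ 0) h2
        rw [e]
        have := D.L.lattice.smul_mem j h2a'Λ
        rw [zsmul_eq_mul] at this
        exact add_mem this hvΛ
      · -- `k = 2j+1`: `a − a′ = j·2a′ + c v ∈ Λ`
        apply hne
        have e : a - a' = (j : ℂ) * (2 * a') + (D.c : ℂ) * v := by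
          have h2 : (2 : ℂ) * (a - a') = 2 * ((j : ℂ) * (2 * a') + (D.c : ℂ) * v) := by
            rw [mul_sub, hrel, hj]; push_cast; ring
          exact mul_left_cancel₀ (by norm_num : (2 : ℂ) ≠ 0) h2
        rw [e]
        have := D.L.lattice.smul_mem j h2a'Λ
        rw [zsmul_eq_mul] at this
        exact add_mem this hvΛ
    · exact hB
  · exact hA

end Shimura

end Summit.BirchSwinnertonDyer.BirchSwinnertonDyer.Theorems.ManinLocalTwoThree.SigmaHabitat

end
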